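import Mathlib
import Summits.KontsevichZagierPeriods.Zeta5Search.BrickWeightedDenominators
import Summits.KontsevichZagierPeriods.Zeta5Search.SymRayZudilinBridge

/-!
# BrickZudilinPartner — Zudilin's 2002 partner series `r̃ₙ`: its partial-fraction data from the cells of `(6,1,1)`, the
inclusions (14) COMPLETE at every odd prime (`ũₙ, d_n²w̃ₙ, d_n⁵ṽₙ ∈ ℤ_(p)`), and `D_n²qₙ, D_n⁷pₙ, D_n⁵p̃ₙ ∈ ℤ_(p)`
(cell zeta5-irr)

HONEST FRAMING: systematic search; no irrationality claim unless certified. INSTRUMENT-tier arithmetic of the ζ(5)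
census cell zeta5-irr (HOME `run/shared/lean/pub/zeta5-irr/`), filed by the engine seat zi-eng (g12); sequel of
`BrickDenominators` (`uₙ, d_n²wₙ, d_n⁵vₙ ∈ ℤ_(p)`) and `BrickWeightedDenominators` (quadratic moments). WHAT THIS IS NOT:
no denominator saving beyond print; nothing at `p = 2` (Zudilin's factors `2`, `4` live there); NOT a discharge of the
named fact `Zudilin2002.integrality` (its `2`-part is not typed); nothing about ζ(5); 0 nats/n; rung F-Z1 NOT moved.

## Statements (`p` an odd prime; cells `c_{K,s}(n)` of the kernel `(6,1,1)` = Zudilin's `rₙ`, `BrickLinearForms`)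

* ZUDILIN'S PARTNER SERIES `r̃ₙ = −n!⁴Σ_k (k+n/2)k(k−1)⋯(k−n)(k+n)⋯(k+2n)/(k)_{n+1}⁶ = ũₙζ(5) + w̃ₙζ(3) − ṽₙ` (Math.
  Notes 72 (2002), (7); tree `Zudilin2002.IsDataRt/dataRt/utC/wtC/vtC`): since its summand is `−k(k+n)` times that of
  `rₙ` and `−k(k+n) = −((k+K)² + (n−2K)(k+K) − K(n−K))`, its partial-fraction data are
  `c̃_{K,s} = −(c_{K,s+2} + (n−2K)c_{K,s+1} − K(n−K)c_{K,s})` (`c_{K,7} = c_{K,8} := 0`) — **`isDataRt_cell`**; the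
  would-be polynomial part dies by `x_1 = x_2 = 0` and `Σ_K K c_{K,1} = 0` (`sum_mul_cell_one`, from the reflection
  `c_{n−K,1} = c_{K,1}` = Krattenthaler–Rivoal's reciprocity read on the cells, `cell_one_reflect`). Hence
  `ũₙ = Σ_K K(n−K)c_{K,5} − Σ_K(n−2K)c_{K,6}` (`utC_eq_cells`), and `w̃ₙ`, `ṽₙ` likewise (`wtC_eq_cells`, `vtC_eq_cells`).
* **(14) at odd primes, partner half**: `ũₙ ∈ ℤ_(p)` (`padicValuation_utC_le`), `ord_p w̃ₙ ≥ −2⌊log_p n⌋`,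
  `ord_p ṽₙ ≥ −5⌊log_p n⌋` (`padicValuation_wtC_le`, `padicValuation_vtC_le`), `d_n²w̃ₙ, d_n⁵ṽₙ ∈ ℤ_(p)`
  (`padicValuation_lcmUpto_pow_mul_wtC_vtC_le`) — by the quadratic-moment theorem plus termwise cell bounds; together
  with `BrickDenominators` ALL SIX inclusions (14) hold at every odd `p` [in print: from Vasilyev's integrals and
  Zudilin's integral identity; Krattenthaler–Rivoal's Théorème 1 covers the `rₙ` half only].
* **`integrality_odd_prime`**: `D_n²qₙ, D_n⁷pₙ, D_n⁵p̃ₙ ∈ ℤ_(p)` for every odd `p` — the inclusions before (6)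
  (`4D_n²qₙ, 4D_n⁷pₙ, 4D_n⁵p̃ₙ ∈ ℤ`, the tree's NAMED FACT `Zudilin2002.integrality`) away from `2`, through (15)
  (`SymRay.eq15`, proved in the tree); `den_two_pow`: the corresponding denominators are powers of `2`.
  [Zudilin, *A third-order Apéry-like recursion for ζ(5)*, Mat. Zametki 72 (2002) 796–800, §1 (before (6)), §2 (14)–(15).]
-/

namespace Summit.KontsevichZagierPeriods.Zeta5Search.BrickZudilinPartner

open Finset Nat WithZero Polynomial
open Summit.KontsevichZagierPeriods.Zeta5Search.BrickLaurent (cell)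
open Summit.KontsevichZagierPeriods.Zeta5Search.BrickPartialFractions (cellZero xCoeff xZero)
open Summit.KontsevichZagierPeriods.Zeta5Search.BrickTopKummer (cell_one_valuation_abs)
open Summit.KontsevichZagierPeriods.Zeta5Search.BrickDenominators (padicValuation_lcmUpto
  den_eq_two_pow_of_padicValuation_le)
open Summit.KontsevichZagierPeriods.Zeta5Search.BrickWeightedDenominators (padicValuation_quadSum_le
  padicValuation_quadSum_zero_le)

noncomputable section

variable {p : ℕ} [Fact p.Prime]

/-! ## Zudilin's partner series `r̃ₙ` (Math. Notes 2002, (7)): its partial-fraction data from the cells of `(6,1,1)` -/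

section Zudilin

open Literature.NumberTheory.Irrationality (Zudilin2002.q Zudilin2002.p Zudilin2002.ptilde)
open Literature.NumberTheory.Irrationality.Zudilin2002 (IsDataRt dataRt isDataRt_dataRt uC wC vC utC wtC vtC utC_eq
  wtC_eq vtC_eq quot_numRt_eq IsDataR.pfEval_eq minorQ minorP minorPt)
open Literature.NumberTheory.Transcendental.BallRivoal (pfEval poch harm)
open Literature.NumberTheory.Irrationality.KrattenthalerRivoal2007 (IsPartialFractionData.reflect)
open Summit.KontsevichZagierPeriods.Zeta5Search.BrickLinearForms (isDataR_cell xCoeff_one xCoeff_eq_zero_of_even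
  harm_eq_sum_Icc)
open Summit.KontsevichZagierPeriods.Zeta5Search.BrickDenominators (isPartialFractionData_cell)

/-- Reflection of the order-one cells of `(6,1,1)`: `c_{n−K,1}(n) = c_{K,1}(n)` (Krattenthaler–Rivoal's reciprocity
(eq:recipari) for the data, `IsPartialFractionData.reflect`, read on the cells). -/
theorem cell_one_reflect (n : ℕ) {K : ℕ} (hK : K ≤ n) : cell 6 1 1 n (n - K) 1 = cell 6 1 1 n K 1 := by
  have h := (isPartialFractionData_cell (A := 6) (B := 1) (by norm_num) (by norm_num) n).reflect
    (o := 0) (show 0 < 6 by norm_num) hK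
  have h1 : ((-1 : ℚ)) ^ (6 * (n + 1) + 1) = -1 := by
    rw [pow_succ, pow_mul]; norm_num
  rw [zero_add, h1] at h
  rw [h]; ring

/-- `Σ_K K·c_{K,1}(n) = 0` (from `c_{n−K,1} = c_{K,1}` and `x_1(n) = Σ_K c_{K,1}(n) = 0`). -/
theorem sum_mul_cell_one (n : ℕ) : ∑ K ∈ range (n + 1), (K : ℚ) * cell 6 1 1 n K 1 = 0 := by
  have hx1 : ∑ K ∈ range (n + 1), cell 6 1 1 n K 1 = 0 := by
    have h := xCoeff_one (A := 6) (B := 1) (ε := 1) (by norm_num) (by norm_num) n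
    rwa [xCoeff] at h
  have hrefl : ∑ K ∈ range (n + 1), (K : ℚ) * cell 6 1 1 n K 1 =
      ∑ K ∈ range (n + 1), ((n : ℚ) - K) * cell 6 1 1 n K 1 := by
    rw [← Finset.sum_range_reflect (fun K => (K : ℚ) * cell 6 1 1 n K 1) (n + 1)]
    refine Finset.sum_congr rfl fun K hK => ?_
    have hKn : K ≤ n := by have := mem_range.1 hK; omega
    rw [show n + 1 - 1 - K = n - K by omega, cell_one_reflect n hKn, Nat.cast_sub hKn]
  have h2 : 2 * ∑ K ∈ range (n + 1), (K : ℚ) * cell 6 1 1 n K 1 = (n : ℚ) * ∑ K ∈ range (n + 1), cell 6 1 1 n K 1 := by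
    rw [two_mul]
    nth_rewrite 1 [hrefl]
    rw [← Finset.sum_add_distrib, Finset.mul_sum]
    exact Finset.sum_congr rfl fun K _ => by ring
  rw [hx1, mul_zero] at h2
  linarith

/-- **The cells of `(6,1,1)` give partial-fraction data of Zudilin's partner summand** `r̃ₙ`:
`−k(k+n)·(numR/(k)_{n+1}⁶)` has, at the pole `−K`, the coefficients
`c̃_{K,s} = −(c_{K,s+2} + (n−2K)c_{K,s+1} − K(n−K)c_{K,s})` (`c_{K,7} = c_{K,8} := 0`), because
`−k(k+n) = −((k+K)² + (n−2K)(k+K) − K(n−K))`; the would-be polynomial part `−Σ_K(c_{K,1}(k+K+n−2K) + c_{K,2})`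
vanishes by `x_1 = x_2 = 0` and `Σ_K K c_{K,1} = 0`. -/
theorem isDataRt_cell (n : ℕ) : IsDataRt n (fun o K =>
    -((if o + 3 ≤ 6 then cell 6 1 1 n K (o + 3) else 0) +
        ((n : ℚ) - 2 * K) * (if o + 2 ≤ 6 then cell 6 1 1 n K (o + 2) else 0) -
          (K : ℚ) * ((n : ℚ) - K) * cell 6 1 1 n K (o + 1))) := by
  intro t ht
  rw [quot_numRt_eq, ← (isDataR_cell n).pfEval_eq t ht]
  simp only [pfEval]
  rw [Finset.mul_sum]
  have key : ∀ K ∈ range (n + 1),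
      (∑ o ∈ range 6, -((if o + 3 ≤ 6 then cell 6 1 1 n K (o + 3) else 0) +
          ((n : ℚ) - 2 * K) * (if o + 2 ≤ 6 then cell 6 1 1 n K (o + 2) else 0) -
            (K : ℚ) * ((n : ℚ) - K) * cell 6 1 1 n K (o + 1)) / (t + K + 1) ^ (o + 1)) =
        -((t + 1) * (t + 1 + n)) * (∑ o ∈ range 6, cell 6 1 1 n K (o + 1) / (t + K + 1) ^ (o + 1)) +
          (cell 6 1 1 n K 1 * (t + K + 1 + ((n : ℚ) - 2 * K)) + cell 6 1 1 n K 2) := by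
    intro K hK
    have hu : t + (K : ℚ) + 1 ≠ 0 := ht K (by have := mem_range.1 hK; omega)
    simp only [Finset.sum_range_succ, Finset.sum_range_zero, zero_add, Nat.reduceAdd, Nat.reduceLeDiff, if_true,
      if_false]
    field_simp
    ring
  rw [Finset.sum_congr rfl key, Finset.sum_add_distrib]
  have hx1 : ∑ K ∈ range (n + 1), cell 6 1 1 n K 1 = 0 := by
    have h := xCoeff_one (A := 6) (B := 1) (ε := 1) (by norm_num) (by norm_num) n
    rwa [xCoeff] at h
  have hx2 : ∑ K ∈ range (n + 1), cell 6 1 1 n K 2 = 0 := by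
    have h := xCoeff_eq_zero_of_even (A := 6) (B := 1) (ε := 1) (by norm_num) (by decide) odd_one (by norm_num) n
      (s := 2) even_two le_rfl (by norm_num)
    rwa [xCoeff] at h
  have hm := sum_mul_cell_one n
  have hjunk : ∑ K ∈ range (n + 1), (cell 6 1 1 n K 1 * (t + K + 1 + ((n : ℚ) - 2 * K)) + cell 6 1 1 n K 2) = 0 := by
    have hrw : ∀ K : ℕ, cell 6 1 1 n K 1 * (t + K + 1 + ((n : ℚ) - 2 * K)) + cell 6 1 1 n K 2 =
        (t + n + 1) * cell 6 1 1 n K 1 - (K : ℚ) * cell 6 1 1 n K 1 + cell 6 1 1 n K 2 := fun K => by ring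
    simp only [hrw, Finset.sum_add_distrib, Finset.sum_sub_distrib, ← Finset.mul_sum, hx1, hx2, hm]
    ring
  rw [hjunk, add_zero]

/-- Zudilin's (chosen) partner data agree with the cell expression on the support `o < 6`, `K ≤ n`. -/
theorem dataRt_eq_cell (n : ℕ) {o K : ℕ} (ho : o < 6) (hK : K ≤ n) :
    dataRt n o K = -((if o + 3 ≤ 6 then cell 6 1 1 n K (o + 3) else 0) +
        ((n : ℚ) - 2 * K) * (if o + 2 ≤ 6 then cell 6 1 1 n K (o + 2) else 0) -
          (K : ℚ) * ((n : ℚ) - K) * cell 6 1 1 n K (o + 1)) :=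
  (isDataRt_dataRt n).eq (isDataRt_cell n) ho hK

/-- **`ũₙ = Σ_K K(n−K)c_{K,5}(n) − Σ_K (n−2K)c_{K,6}(n)`**: Zudilin's partner `ζ(5)`-coefficient is a quadratic moment of
the order-5 cells plus a linear moment of the (integral) top cells of `(6,1,1)`. -/
theorem utC_eq_cells (n : ℕ) : utC n = ∑ K ∈ range (n + 1),
    ((K : ℚ) * ((n : ℚ) - K) * cell 6 1 1 n K 5 - ((n : ℚ) - 2 * K) * cell 6 1 1 n K 6) := by
  rw [utC_eq (isDataRt_cell n)]
  refine Finset.sum_congr rfl fun K _ => ?_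
  simp only [Nat.reduceAdd, Nat.reduceLeDiff, if_true, if_false, zero_add]
  ring

/-- **`w̃ₙ = −Σ_K (c_{K,5} + (n−2K)c_{K,4} − K(n−K)c_{K,3})(n)`**. -/
theorem wtC_eq_cells (n : ℕ) : wtC n = -∑ K ∈ range (n + 1),
    (cell 6 1 1 n K 5 + ((n : ℚ) - 2 * K) * cell 6 1 1 n K 4 - (K : ℚ) * ((n : ℚ) - K) * cell 6 1 1 n K 3) := by
  rw [wtC_eq (isDataRt_cell n), ← Finset.sum_neg_distrib]
  refine Finset.sum_congr rfl fun K _ => ?_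
  simp only [Nat.reduceAdd, Nat.reduceLeDiff, if_true]

/-- **`ṽₙ`** from the cells: `ṽₙ = Σ_{o<6}Σ_K c̃_{K,o+1}H_K^{(o+1)}` with the cell expression for `c̃`. -/
theorem vtC_eq_cells (n : ℕ) : vtC n = ∑ o ∈ range 6, ∑ K ∈ range (n + 1),
    -((if o + 3 ≤ 6 then cell 6 1 1 n K (o + 3) else 0) +
        ((n : ℚ) - 2 * K) * (if o + 2 ≤ 6 then cell 6 1 1 n K (o + 2) else 0) -
          (K : ℚ) * ((n : ℚ) - K) * cell 6 1 1 n K (o + 1)) * harm (o + 1) K :=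
  vtC_eq (isDataRt_cell n)


/-! ### Zudilin's inclusions (14) for the partner coefficients, at every odd prime -/

section valuations

open Summit.KontsevichZagierPeriods.Zeta5Search.BrickHarmonicBlocks (hsum)
open Summit.KontsevichZagierPeriods.Zeta5Search.BrickDigitStepDZero (hsum_valuation)
open Summit.KontsevichZagierPeriods.Zeta5Search.BrickDenominators (padicValuation_xCoeff_le padicValuation_uC_le
  padicValuation_lcmUpto_sq_mul_wC_le padicValuation_lcmUpto_pow_five_mul_vC_le)

/-- An integer linear expression `n − 2K` is `p`-integral. [folklore] -/
theorem padicValuation_sub_two_mul_le (n K : ℕ) : Rat.padicValuation p ((n : ℚ) - 2 * K) ≤ 1 := by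
  rw [show ((n : ℚ) - 2 * K) = ((n - 2 * K : ℤ) : ℚ) by push_cast; ring, Rat.padicValuation_cast]
  exact Int.padicValuation_le_one _ _

/-- `harm s K = hsum s K` (`= H_K^{(s)}`; the Ball–Rivoal and the chain's spellings). -/
theorem harm_eq_hsum (s K : ℕ) : harm s K = hsum s K := by
  rw [harm_eq_sum_Icc]; rfl

variable (hp2 : p ≠ 2)
include hp2

/-- **`ũₙ ∈ ℤ_(p)` for every odd prime `p`** (Zudilin 2002 (14): `2ũₙ ∈ ℤ`): the quadratic moment of the order-5 cells
has the exponent `A−1−5 = 0`, and the top cells `c_{K,6}` are `p`-integral termwise. -/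
theorem padicValuation_utC_le (n : ℕ) : Rat.padicValuation p (utC n) ≤ 1 := by
  have hp : p.Prime := Fact.out
  have hn : n < p ^ (Nat.log p n + 1) := Nat.lt_pow_succ_log_self hp.one_lt n
  rw [utC_eq_cells, Finset.sum_sub_distrib]
  refine (Valuation.map_sub _ _ _).trans (max_le ?_ (Valuation.map_sum_le _ fun K hK => ?_))
  · have h := padicValuation_quadSum_le hp2 (A := 6) (B := 1) (by decide) le_rfl (by norm_num) n 5
    rwa [show (6 - 1 - 5 : ℕ) = 0 from rfl, Nat.cast_zero, mul_zero, exp_zero] at h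
  · have hKn : K ≤ n := by have := mem_range.1 hK; omega
    rw [map_mul]
    refine mul_le_one' (padicValuation_sub_two_mul_le n K) ?_
    have h := cell_one_valuation_abs hp2 (A := 6) (B := 1) (by norm_num) hn hKn 6
    rwa [show (6 - 6 : ℕ) = 0 from rfl, Nat.cast_zero, mul_zero, exp_zero] at h

/-- **`ord_p w̃ₙ ≥ −2⌊log_p n⌋` for every odd prime `p`** (Zudilin 2002 (14): `2D_n²w̃ₙ ∈ ℤ`). -/
theorem padicValuation_wtC_le (n : ℕ) : Rat.padicValuation p (wtC n) ≤ exp ((Nat.log p n : ℤ) * 2) := by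
  have hp : p.Prime := Fact.out
  have hn : n < p ^ (Nat.log p n + 1) := Nat.lt_pow_succ_log_self hp.one_lt n
  rw [wtC_eq_cells, Valuation.map_neg, Finset.sum_sub_distrib, Finset.sum_add_distrib]
  refine (Valuation.map_sub _ _ _).trans (max_le ((Valuation.map_add _ _ _).trans (max_le ?_
    (Valuation.map_sum_le _ fun K hK => ?_))) ?_)
  · have h := padicValuation_xCoeff_le hp2 (A := 6) (B := 1) (by decide) le_rfl (by norm_num) n 5
    rw [xCoeff, show (6 - 1 - 5 : ℕ) = 0 from rfl, Nat.cast_zero, mul_zero] at h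
    exact h.trans (exp_le_exp.2 (by positivity))
  · have hKn : K ≤ n := by have := mem_range.1 hK; omega
    rw [map_mul]
    have h := cell_one_valuation_abs hp2 (A := 6) (B := 1) (by norm_num) hn hKn 4
    rw [show (6 - 4 : ℕ) = 2 from rfl, Nat.cast_ofNat] at h
    simpa only [one_mul] using mul_le_mul' (padicValuation_sub_two_mul_le n K) h
  · have h := padicValuation_quadSum_le hp2 (A := 6) (B := 1) (by decide) le_rfl (by norm_num) n 3
    rwa [show (6 - 1 - 3 : ℕ) = 2 from rfl, Nat.cast_ofNat] at h

/-- **`ord_p ṽₙ ≥ −5⌊log_p n⌋` for every odd prime `p`** (Zudilin 2002 (14): `2D_n⁵ṽₙ ∈ ℤ`): the three groups of the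
cell expression are bounded termwise (`c_{K,o+3}H^{(o+1)}`: `4L`; `(n−2K)c_{K,o+2}H^{(o+1)}`: `5L`) and, for the quadratic
moment of the harmonic cells `Σ_K K(n−K)cell^{(0)}_K`, by H^∞ (`5L` instead of the termwise `6L`). -/
theorem padicValuation_vtC_le (n : ℕ) : Rat.padicValuation p (vtC n) ≤ exp ((Nat.log p n : ℤ) * 5) := by
  have hp : p.Prime := Fact.out
  set L := Nat.log p n with hL
  have hn : n < p ^ (L + 1) := Nat.lt_pow_succ_log_self hp.one_lt n
  have hH : ∀ K, K ≤ n → ∀ s, Rat.padicValuation p (harm s K) ≤ exp ((L : ℤ) * s) := fun K hK s => by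
    rw [harm_eq_hsum]; exact hsum_valuation (lt_of_le_of_lt hK hn) s
  -- split the summand into the three groups
  have hsplit : vtC n =
      -(∑ o ∈ range 6, ∑ K ∈ range (n + 1),
          (if o + 3 ≤ 6 then cell 6 1 1 n K (o + 3) else 0) * harm (o + 1) K) -
        (∑ o ∈ range 6, ∑ K ∈ range (n + 1),
          ((n : ℚ) - 2 * K) * (if o + 2 ≤ 6 then cell 6 1 1 n K (o + 2) else 0) * harm (o + 1) K) +
        ∑ K ∈ range (n + 1), ((K : ℚ) * ((n : ℚ) - K)) *
          ∑ o ∈ range 6, cell 6 1 1 n K (o + 1) * harm (o + 1) K := by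
    rw [vtC_eq_cells]
    rw [Finset.sum_comm (s := range 6) (t := range (n + 1)), Finset.sum_comm (s := range 6) (t := range (n + 1)),
      Finset.sum_comm (s := range 6) (t := range (n + 1))]
    rw [← Finset.sum_neg_distrib, ← Finset.sum_sub_distrib, ← Finset.sum_add_distrib]
    refine Finset.sum_congr rfl fun K _ => ?_
    rw [← Finset.sum_neg_distrib, ← Finset.sum_sub_distrib, Finset.mul_sum, ← Finset.sum_add_distrib]
    exact Finset.sum_congr rfl fun o _ => by ring
  have hquad : ∑ K ∈ range (n + 1), ((K : ℚ) * ((n : ℚ) - K)) * ∑ o ∈ range 6, cell 6 1 1 n K (o + 1) * harm (o + 1) K =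
      -∑ K ∈ range (n + 1), ((K : ℚ) * ((n : ℚ) - K)) * cellZero 6 1 1 n K := by
    rw [← Finset.sum_neg_distrib]
    refine Finset.sum_congr rfl fun K _ => ?_
    rw [cellZero, mul_neg, neg_neg, ← Finset.Ico_add_one_right_eq_Icc, Finset.sum_Ico_eq_sum_range]
    refine congrArg _ (Finset.sum_congr rfl fun o _ => ?_)
    rw [add_comm 1 o, harm_eq_hsum, hsum]
  rw [hsplit, hquad]
  refine (Valuation.map_add _ _ _).trans (max_le ((Valuation.map_sub _ _ _).trans (max_le ?_ ?_)) ?_)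
  · rw [Valuation.map_neg]
    refine Valuation.map_sum_le _ fun o ho => Valuation.map_sum_le _ fun K hK => ?_
    have hKn : K ≤ n := by have := mem_range.1 hK; omega
    have ho' : o < 6 := mem_range.1 ho
    split_ifs with h3
    · rw [map_mul]
      refine (mul_le_mul' (cell_one_valuation_abs hp2 (A := 6) (B := 1) (by norm_num) hn hKn (o + 3))
        (hH K hKn (o + 1))).trans ?_
      rw [← exp_add, exp_le_exp]
      have : ((6 - (o + 3) : ℕ) : ℤ) + (o + 1 : ℕ) = 4 := by omega
      nlinarith [Int.natCast_nonneg L, this]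
    · rw [zero_mul, map_zero]; exact _root_.zero_le
  · refine Valuation.map_sum_le _ fun o ho => Valuation.map_sum_le _ fun K hK => ?_
    have hKn : K ≤ n := by have := mem_range.1 hK; omega
    have ho' : o < 6 := mem_range.1 ho
    split_ifs with h2
    · rw [map_mul, map_mul]
      refine (mul_le_mul' (mul_le_mul' (padicValuation_sub_two_mul_le n K)
        (cell_one_valuation_abs hp2 (A := 6) (B := 1) (by norm_num) hn hKn (o + 2))) (hH K hKn (o + 1))).trans ?_
      rw [one_mul, ← exp_add, exp_le_exp]
      have : ((6 - (o + 2) : ℕ) : ℤ) + (o + 1 : ℕ) = 5 := by omega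
      nlinarith [Int.natCast_nonneg L, this]
    · rw [mul_zero, zero_mul, map_zero]; exact _root_.zero_le
  · rw [Valuation.map_neg]
    have h := padicValuation_quadSum_zero_le hp2 (A := 6) (B := 1) (by decide) le_rfl (by norm_num) n
    rwa [show (6 - 1 : ℕ) = 5 from rfl, Nat.cast_ofNat] at h

/-- **`d_n²·w̃ₙ ∈ ℤ_(p)` and `d_n⁵·ṽₙ ∈ ℤ_(p)` for every odd prime `p`** (`d_n = lcm(1,…,n)`). -/
theorem padicValuation_lcmUpto_pow_mul_wtC_vtC_le (n : ℕ) :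
    Rat.padicValuation p (((Nat.lcmUpto n : ℕ) : ℚ) ^ 2 * wtC n) ≤ 1 ∧
      Rat.padicValuation p (((Nat.lcmUpto n : ℕ) : ℚ) ^ 5 * vtC n) ≤ 1 := by
  refine ⟨?_, ?_⟩
  · rw [map_mul, map_pow, padicValuation_lcmUpto, ← exp_nsmul, nsmul_eq_mul]
    refine (mul_le_mul_right (padicValuation_wtC_le hp2 n) _).trans (le_of_eq ?_)
    rw [← exp_add, ← exp_zero]; congr 1; ring
  · rw [map_mul, map_pow, padicValuation_lcmUpto, ← exp_nsmul, nsmul_eq_mul]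
    refine (mul_le_mul_right (padicValuation_vtC_le hp2 n) _).trans (le_of_eq ?_)
    rw [← exp_add, ← exp_zero]; congr 1; ring

/-- **Zudilin 2002, the integrality behind (6) at every odd prime** (the odd part of the tree's named fact
`Zudilin2002.integrality`: `4D_n²qₙ, 4D_n⁷pₙ, 4D_n⁵p̃ₙ ∈ ℤ`): for every odd prime `p` and every `n`,
`D_n²qₙ, D_n⁷pₙ, D_n⁵p̃ₙ ∈ ℤ_(p)` — via (15) `qₙ = uₙw̃ₙ − ũₙwₙ`, `pₙ = w̃ₙvₙ − wₙṽₙ`, `p̃ₙ = uₙṽₙ − ũₙvₙ`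
(`SymRay.eq15`, PROVED in the tree) and the six inclusions (14) at odd `p`. The factor `4` of the print is the
`2`-adic content, not typed here. -/
theorem integrality_odd_prime (n : ℕ) :
    Rat.padicValuation p (((Nat.lcmUpto n : ℕ) : ℚ) ^ 2 * Zudilin2002.q n) ≤ 1 ∧
      Rat.padicValuation p (((Nat.lcmUpto n : ℕ) : ℚ) ^ 7 * Zudilin2002.p n) ≤ 1 ∧
        Rat.padicValuation p (((Nat.lcmUpto n : ℕ) : ℚ) ^ 5 * Zudilin2002.ptilde n) ≤ 1 := by
  obtain ⟨hq, hpp, hpt⟩ := SymRay.eq15 n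
  obtain ⟨hwt, hvt⟩ := padicValuation_lcmUpto_pow_mul_wtC_vtC_le hp2 n
  have hu := padicValuation_uC_le hp2 n
  have hut := padicValuation_utC_le hp2 n
  have hw := padicValuation_lcmUpto_sq_mul_wC_le hp2 n
  have hv := padicValuation_lcmUpto_pow_five_mul_vC_le hp2 n
  set d : ℚ := ((Nat.lcmUpto n : ℕ) : ℚ) with hd
  refine ⟨?_, ?_, ?_⟩
  · rw [hq, minorQ, show d ^ 2 * (uC n * wtC n - utC n * wC n) =
        uC n * (d ^ 2 * wtC n) - utC n * (d ^ 2 * wC n) by ring]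
    refine (Valuation.map_sub _ _ _).trans (max_le ?_ ?_)
    · rw [map_mul]; exact mul_le_one' hu hwt
    · rw [map_mul]; exact mul_le_one' hut hw
  · rw [hpp, minorP, show d ^ 7 * (wtC n * vC n - wC n * vtC n) =
        (d ^ 2 * wtC n) * (d ^ 5 * vC n) - (d ^ 2 * wC n) * (d ^ 5 * vtC n) by ring]
    refine (Valuation.map_sub _ _ _).trans (max_le ?_ ?_)
    · rw [map_mul]; exact mul_le_one' hwt hv
    · rw [map_mul]; exact mul_le_one' hw hvt
  · rw [hpt, minorPt, show d ^ 5 * (uC n * vtC n - utC n * vC n) =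
        uC n * (d ^ 5 * vtC n) - utC n * (d ^ 5 * vC n) by ring]
    refine (Valuation.map_sub _ _ _).trans (max_le ?_ ?_)
    · rw [map_mul]; exact mul_le_one' hu hvt
    · rw [map_mul]; exact mul_le_one' hut hv

omit hp2 in
/-- Across the odd primes: the denominators of `ũₙ`, `D_n²w̃ₙ`, `D_n⁵ṽₙ`, `D_n⁷pₙ`, `D_n⁵p̃ₙ` are powers of `2`. -/
theorem den_two_pow (n : ℕ) :
    (∃ k : ℕ, (utC n).den = 2 ^ k) ∧
      (∃ k : ℕ, (((Nat.lcmUpto n : ℕ) : ℚ) ^ 2 * wtC n).den = 2 ^ k) ∧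
      (∃ k : ℕ, (((Nat.lcmUpto n : ℕ) : ℚ) ^ 5 * vtC n).den = 2 ^ k) ∧
      (∃ k : ℕ, (((Nat.lcmUpto n : ℕ) : ℚ) ^ 7 * Zudilin2002.p n).den = 2 ^ k) ∧
        ∃ k : ℕ, (((Nat.lcmUpto n : ℕ) : ℚ) ^ 5 * Zudilin2002.ptilde n).den = 2 ^ k :=
  ⟨den_eq_two_pow_of_padicValuation_le fun p hp hp2 => @padicValuation_utC_le p ⟨hp⟩ hp2 n,
    den_eq_two_pow_of_padicValuation_le fun p hp hp2 => (@padicValuation_lcmUpto_pow_mul_wtC_vtC_le p ⟨hp⟩ hp2 n).1,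
    den_eq_two_pow_of_padicValuation_le fun p hp hp2 => (@padicValuation_lcmUpto_pow_mul_wtC_vtC_le p ⟨hp⟩ hp2 n).2,
    den_eq_two_pow_of_padicValuation_le fun p hp hp2 => (@integrality_odd_prime p ⟨hp⟩ hp2 n).2.1,
    den_eq_two_pow_of_padicValuation_le fun p hp hp2 => (@integrality_odd_prime p ⟨hp⟩ hp2 n).2.2⟩

end valuations

end Zudilin

end

end Summit.KontsevichZagierPeriods.Zeta5Search.BrickZudilinPartner
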